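import Summits.BirchSwinnertonDyer.BirchSwinnertonDyer.Theorems.QuadraticBranchSignedControlPlusEtaNonsurjPlusCoeffCongruenceLambda
import HarnessLib

/-!
# Route `QuadraticBranchSignedControl` (rung K8, cell `bsd-potss`), residual crux `PlusEtaMainConjectureNonsurj`
# (stmt-BirchSwinnertonDyer-19606): THE λ⁺-READING AT THE EDGE `λ = p − 1` — the CORRECTED top moment
# `c = coeff_{p−1}θ_{2m}(η) − (ω⁻_{2m})_{p−1}·θ_{2m}(η)(0)/p^m` (seat `bsd-potss-k8eta-c2` g25; sequel of `…PlusCoeffCongruenceLambda.lean`)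

WHY. The plain λ⁺-reading (`lambda_reading_plus_of_padicNorm`) needs `λ < p − 1`: in the unitriangular identity
`coeff_kθ_{2m}(η) = (−1)^{m+1}Σ_{s+t=k}(ω⁻_{2m})_s·coeff_tM⁺ + p^{2m}r` the off-diagonal structure constant `(ω⁻_{2m})_{p−1}` is only
`≡ p^{m−1} (mod p^m)` (the factor `Φ_p(1+X)` of `ω⁻_{2m}` has degree `p − 1`), so at `k = p − 1` the term `(ω⁻_{2m})_{p−1}·M⁺(0)` competes with the
diagonal `p^m·coeff_{p−1}M⁺`. But `M⁺(0)` is known EXACTLY from the symbols — `θ_{2m}(η)(0) = (−1)^{m+1}p^m·M⁺(0)` (`coeff_zero_mazurTate_plus_eq`) — so ONE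
step of Gaussian elimination removes it: with `c := coeff_{p−1}θ_{2m}(η) − (ω⁻_{2m})_{p−1}·coeff₀θ_{2m}(η)/p^m`,
`c = (−1)^{m+1}[p^m·coeff_{p−1}M⁺ + Σ_{1 ≤ s ≤ p−2}(ω⁻_{2m})_s·coeff_{p−1−s}M⁺] + p^{2m}r`, all of whose off-diagonal constants ARE divisible by `p^m`.
Hence THE EDGE READING: «`‖ϖ·coeff_jθ_{2m}(η)‖ ≤ p^{−(m+1)}` for `j < p − 1` and `‖ϖ·c‖ = p^{−m}`» ⟹ `coeff_jL ∉ ℤ_pˣ` (`j < p−1`), `coeff_{p−1}L ∈ ℤ_pˣ`,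
i.e. `μ(L) = 0`, `λ(L) = p − 1`, for every plus branch function `L`. At level `2` (`m = 1`) `ω⁻₂ = Φ_p(1+X)` is monic of degree `p − 1`, so
`c = b_{p−1} − b₀/p`: at `p = 5` this reads `λ⁺ = 4` (k8eta-c2 g25 P-25H, pre-registered: 57/57 rows of the CM census with PARI `λ⁺ = 4` have
`v₅(b₄ − b₀/5) = 1`, 80/80 rows with `λ⁺ ≥ 5` have `≥ 2`; `p = 7`: 3/3 and 6/6). The same elimination, iterated, reads every `λ` at a high enough
level (each `p − 1` steps cost one unit of precision); only the first step is formalised here.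

WHAT. §14 `forall_norm_le_of_forall_norm_theta_le_plus'` (the induction of the prequel with the bound relaxed to `λ ≤ p − 1`),
`norm_corrected_sub_le_plus` (the corrected step at `k = p − 1`), `lambda_reading_plus_edge_of_padicNorm` (the edge reading),
`hasUnitContent_and_mu_lam_plus_edge_of_padicNorm` (bridge to `HasUnitContent ∧ μ = 0 ∧ lam = p − 1 ∧ normLam = p − 1`).

HONEST FRAMING (cell `bsd-potss`; FULL-BSD rank ≤ 1 programme, HUMAN RULING D-0036/D-0074): TOOL THEOREMS ONLY — no definition, no named fact,
no `sorry`, axioms standard; nothing about (A), (C1⁺_η), C-cc-1 or `BSD(W,p)` of any pair is claimed; no stub of 19606 is proved; crux and route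
OPEN; nothing booked. `--supports stmt-BirchSwinnertonDyer-19606`.

References: [Pollack2003] Prop. 6.18, §6.5; [Kobayashi2003] Thm. 3.2, (3.4), (3.6) (p. 7); [Washington1997] §7.1.
-/

set_option autoImplicit false
set_option linter.dupNamespace false
noncomputable section

open scoped Classical MatrixGroups ModularForm

open CongruenceSubgroup Polynomial Literature.NumberTheory.EllipticCurves
  Literature.NumberTheory.EllipticCurves.ModularForms
  Literature.NumberTheory.EllipticCurves.GreenbergVatsal2000
open Summit.BirchSwinnertonDyer.Rank1Residual Summit.BirchSwinnertonDyer.Rank1Residual.Additive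
open Summit.BirchSwinnertonDyer.BirchSwinnertonDyer.Theorems.EtaMinusCoeffCongruence

namespace Summit.BirchSwinnertonDyer.BirchSwinnertonDyer.Theorems.EtaPlusCoeffCongruence

variable {p : ℕ} [hp : Fact p.Prime] {N : ℕ} [NeZero N] {f : CuspForm (Gamma0 N) 2}

/-! ## §14 The edge `λ = p − 1` -/

/-- The induction of `forall_norm_le_of_forall_norm_theta_le_plus` with the bound relaxed to `λ ≤ p − 1` (its proof only ever uses `j < λ ≤ p − 1`):
`‖ϖ·coeff_jθ_{2m}(η)‖ ≤ p^{−(m+1)}` for all `j < λ` gives `‖ϖ·coeff_jM‖ ≤ p^{−1}` for all `j < λ`. [cite: Pollack2003, Prop. 6.18] -/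
theorem forall_norm_le_of_forall_norm_theta_le_plus' (hp2 : p ≠ 2) (hf0 : IsNewform0 f) (hQ : coeffField f = ⊥)
    (hpN : ¬ p ∣ N) (hap : cuspCoeff f p = ((0 : ℤ) : ℂ)) (m : ℕ) (hm : 1 ≤ m) {lam : ℕ} (hlam : lam ≤ p - 1)
    {M : IwasawaAlgebra p}
    (hM : IsCongrModOmega p (2 * m) (quadraticBranchMazurTateElement p f (2 * m))
      ((-1) ^ (m + 1) * cyclotomicOmegaMinus p (2 * m)) M)
    {ϖ : ℚ_[p]} (hϖ : ‖ϖ‖ ≤ 1)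
    (hθ : ∀ j < lam,
      ‖ϖ * (((quadraticBranchMazurTateElement p f (2 * m)).coeff j : ℚ) : ℚ_[p])‖ ≤ ((p : ℝ)⁻¹) ^ (m + 1)) :
    ∀ j < lam, ‖ϖ * ((PowerSeries.coeff j M : ℤ_[p]) : ℚ_[p])‖ ≤ (p : ℝ)⁻¹ := by
  have hP : p.Prime := hp.out
  have hp1 : (1 : ℝ) < p := by exact_mod_cast hP.one_lt
  have hp0 : (0 : ℝ) < p := by positivity
  have hp2' : 2 ≤ p := hP.two_le
  intro j
  induction j using Nat.strong_induction_on with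
  | _ j ih =>
    intro hj
    obtain ⟨r, hr⟩ := exists_coeff_mazurTate_plus_eq_sum hp2 hf0 hQ hpN hap m (show j < p by omega) hM
    have hstep := norm_sub_le_of_forall_norm_le_plus m hm (show j < p - 1 by omega) hr hϖ
      (fun t ht ↦ ih t ht (by omega))
    have hθj := hθ j hj
    set a : ℚ_[p] := ϖ * (((quadraticBranchMazurTateElement p f (2 * m)).coeff j : ℚ) : ℚ_[p]) with ha
    set b : ℚ_[p] := (-1 : ℚ_[p]) ^ (m + 1) * (p : ℚ_[p]) ^ m *
      (ϖ * ((PowerSeries.coeff j M : ℤ_[p]) : ℚ_[p])) with hb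
    have hle : ‖b‖ ≤ ((p : ℝ)⁻¹) ^ (m + 1) := by
      have e : b = a + -(a - b) := by ring
      rw [e]
      refine (IsUltrametricDist.norm_add_le_max _ _).trans (max_le hθj ?_)
      rw [norm_neg]
      exact hstep
    rw [hb] at hle
    rw [norm_mul, norm_mul, norm_pow, norm_neg, norm_one, one_pow, one_mul, norm_pow, Padic.norm_p, pow_succ] at hle
    have hpm : (0 : ℝ) < ((p : ℝ)⁻¹) ^ m := pow_pos (inv_pos.mpr hp0) m
    exact le_of_mul_le_mul_left hle hpm

omit [NeZero N] in
/-- **The corrected step at the edge `k = p − 1`.** From the identity at `k = p − 1`, the EXACT constant term `θ₀ := coeff₀θ_{2m}(η) = (−1)^{m+1}p^m·M(0)`,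
`‖ϖ‖_p ≤ 1`, `m ≥ 1`, `p ≥ 3` and `‖ϖ·coeff_tM‖ ≤ p^{−1}` for `1 ≤ t ≤ p − 2`: with `c := coeff_{p−1}θ − (ω⁻_{2m})_{p−1}·θ₀/p^m`,
`‖ϖ·c − (−1)^{m+1}p^m·ϖ·coeff_{p−1}M‖ ≤ p^{−(m+1)}` (the term `(ω⁻_{2m})_{p−1}·M(0)` is removed exactly; every remaining off-diagonal constant
`(ω⁻_{2m})_s`, `1 ≤ s ≤ p−2`, is divisible by `p^m`). [cite: Pollack2003, Prop. 6.18] -/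
theorem norm_corrected_sub_le_plus (hp3 : 3 ≤ p) (m : ℕ) (hm : 1 ≤ m) {M : IwasawaAlgebra p} {θk θ0 : ℚ_[p]} {r : ℤ_[p]}
    (hid : θk = (-1) ^ (m + 1) * (∑ x ∈ Finset.HasAntidiagonal.antidiagonal (p - 1),
        (((cyclotomicOmegaMinus p (2 * m)).coeff x.1 : ℤ) : ℚ_[p]) * ((PowerSeries.coeff x.2 M : ℤ_[p]) : ℚ_[p])) +
        (p : ℚ_[p]) ^ (2 * m) * (r : ℚ_[p]))
    (h0 : θ0 = (-1) ^ (m + 1) * (p : ℚ_[p]) ^ m * ((PowerSeries.constantCoeff M : ℤ_[p]) : ℚ_[p]))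
    {ϖ : ℚ_[p]} (hϖ : ‖ϖ‖ ≤ 1)
    (hIH : ∀ t, 1 ≤ t → t < p - 1 → ‖ϖ * ((PowerSeries.coeff t M : ℤ_[p]) : ℚ_[p])‖ ≤ (p : ℝ)⁻¹) :
    ‖ϖ * (θk - (((cyclotomicOmegaMinus p (2 * m)).coeff (p - 1) : ℤ) : ℚ_[p]) * θ0 / (p : ℚ_[p]) ^ m) -
      (-1) ^ (m + 1) * (p : ℚ_[p]) ^ m * (ϖ * ((PowerSeries.coeff (p - 1) M : ℤ_[p]) : ℚ_[p]))‖ ≤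
      ((p : ℝ)⁻¹) ^ (m + 1) := by
  have hP : p.Prime := hp.out
  have hp1 : (1 : ℝ) < p := by exact_mod_cast hP.one_lt
  have hp0 : (0 : ℝ) < p := by positivity
  have hpi0 : (0 : ℝ) ≤ (p : ℝ)⁻¹ := inv_nonneg.mpr hp0.le
  have hpi1 : (p : ℝ)⁻¹ ≤ 1 := inv_le_one_of_one_le₀ hp1.le
  have hpQ : (p : ℚ_[p]) ^ m ≠ 0 := pow_ne_zero _ (by exact_mod_cast hP.ne_zero)
  set S := Finset.HasAntidiagonal.antidiagonal (p - 1) with hS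
  set g : ℕ × ℕ → ℚ_[p] := fun x ↦
    (((cyclotomicOmegaMinus p (2 * m)).coeff x.1 : ℤ) : ℚ_[p]) * ((PowerSeries.coeff x.2 M : ℤ_[p]) : ℚ_[p]) with hg
  have hmem1 : ((0, p - 1) : ℕ × ℕ) ∈ S := by rw [hS, Finset.HasAntidiagonal.mem_antidiagonal]; simp
  have hmem2 : ((p - 1, 0) : ℕ × ℕ) ∈ S.erase (0, p - 1) := by
    rw [Finset.mem_erase, hS, Finset.HasAntidiagonal.mem_antidiagonal]
    refine ⟨fun h ↦ ?_, by simp⟩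
    have := (Prod.mk.injEq _ _ _ _).mp h
    omega
  set S'' := (S.erase (0, p - 1)).erase (p - 1, 0) with hS''
  have hsplit : ∑ x ∈ S, g x = g (0, p - 1) + (g (p - 1, 0) + ∑ x ∈ S'', g x) := by
    rw [← Finset.add_sum_erase S g hmem1, ← Finset.add_sum_erase _ g hmem2]
  have hg1 : g (0, p - 1) = (p : ℚ_[p]) ^ m * ((PowerSeries.coeff (p - 1) M : ℤ_[p]) : ℚ_[p]) := by
    rw [hg]; dsimp only; rw [coeff_zero_cyclotomicOmegaMinus_two_mul]; push_cast; ring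
  have hg2 : g (p - 1, 0) = (((cyclotomicOmegaMinus p (2 * m)).coeff (p - 1) : ℤ) : ℚ_[p]) *
      ((PowerSeries.constantCoeff M : ℤ_[p]) : ℚ_[p]) := by
    rw [hg]; dsimp only; rw [PowerSeries.coeff_zero_eq_constantCoeff]
  -- the corrected difference
  have hcorr : (((cyclotomicOmegaMinus p (2 * m)).coeff (p - 1) : ℤ) : ℚ_[p]) * θ0 / (p : ℚ_[p]) ^ m =
      (-1) ^ (m + 1) * g (p - 1, 0) := by
    rw [h0, hg2]; field_simp
  have hms : ϖ * ∑ x ∈ S'', g x = ∑ x ∈ S'', ϖ * g x := by rw [Finset.mul_sum]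
  have hdiff : ϖ * (θk - (((cyclotomicOmegaMinus p (2 * m)).coeff (p - 1) : ℤ) : ℚ_[p]) * θ0 / (p : ℚ_[p]) ^ m) -
      (-1) ^ (m + 1) * (p : ℚ_[p]) ^ m * (ϖ * ((PowerSeries.coeff (p - 1) M : ℤ_[p]) : ℚ_[p])) =
      (-1) ^ (m + 1) * ∑ x ∈ S'', ϖ * g x + (p : ℚ_[p]) ^ (2 * m) * (ϖ * (r : ℚ_[p])) := by
    rw [hcorr, ← hms, hid, hsplit, hg1]
    ring
  rw [hdiff]
  have hterm : ∀ x ∈ S'', ‖ϖ * g x‖ ≤ ((p : ℝ)⁻¹) ^ (m + 1) := by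
    intro x hx
    obtain ⟨hne2, hx'⟩ := Finset.mem_erase.mp hx
    obtain ⟨hne1, hxS⟩ := Finset.mem_erase.mp hx'
    have hsum : x.1 + x.2 = p - 1 := by rw [hS] at hxS; exact Finset.HasAntidiagonal.mem_antidiagonal.mp hxS
    have hx1 : 1 ≤ x.1 := by
      rcases Nat.eq_zero_or_pos x.1 with h0' | h0'
      · exact absurd (Prod.ext h0' (by show x.2 = p - 1; omega)) hne1
      · exact h0'
    have hx2 : 1 ≤ x.2 := by
      rcases Nat.eq_zero_or_pos x.2 with h0' | h0'
      · exact absurd (Prod.ext (by show x.1 = p - 1; omega) h0') hne2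
      · exact h0'
    have hx1lt : x.1 < p - 1 := by omega
    have hdvd := pow_dvd_coeff_cyclotomicOmegaMinus_two_mul (p := p) m x.1 hx1lt
    have hω : ‖(((cyclotomicOmegaMinus p (2 * m)).coeff x.1 : ℤ) : ℚ_[p])‖ ≤ (p : ℝ) ^ (-(m : ℤ)) :=
      (Padic.norm_int_le_pow_iff_dvd _ _).mpr (by exact_mod_cast hdvd)
    have hMt := hIH x.2 hx2 (by omega)
    rw [hg]
    dsimp only
    calc ‖ϖ * ((((cyclotomicOmegaMinus p (2 * m)).coeff x.1 : ℤ) : ℚ_[p]) *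
          ((PowerSeries.coeff x.2 M : ℤ_[p]) : ℚ_[p]))‖
        = ‖(((cyclotomicOmegaMinus p (2 * m)).coeff x.1 : ℤ) : ℚ_[p])‖ *
            ‖ϖ * ((PowerSeries.coeff x.2 M : ℤ_[p]) : ℚ_[p])‖ := by
          rw [← norm_mul]; ring_nf
      _ ≤ (p : ℝ) ^ (-(m : ℤ)) * (p : ℝ)⁻¹ := mul_le_mul hω hMt (norm_nonneg _) (by positivity)
      _ = ((p : ℝ)⁻¹) ^ (m + 1) := by rw [zpow_neg, zpow_natCast, ← inv_pow, pow_succ]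
  have hsum_le : ‖∑ x ∈ S'', ϖ * g x‖ ≤ ((p : ℝ)⁻¹) ^ (m + 1) :=
    IsUltrametricDist.norm_sum_le_of_forall_le_of_nonneg (by positivity) hterm
  have hA : ‖(-1 : ℚ_[p]) ^ (m + 1) * ∑ x ∈ S'', ϖ * g x‖ ≤ ((p : ℝ)⁻¹) ^ (m + 1) := by
    rw [norm_mul, norm_pow, norm_neg, norm_one, one_pow, one_mul]; exact hsum_le
  have hB : ‖(p : ℚ_[p]) ^ (2 * m) * (ϖ * (r : ℚ_[p]))‖ ≤ ((p : ℝ)⁻¹) ^ (m + 1) := by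
    rw [norm_mul, norm_mul, norm_pow, Padic.norm_p, PadicInt.padic_norm_e_of_padicInt]
    calc ((p : ℝ)⁻¹) ^ (2 * m) * (‖ϖ‖ * ‖r‖) ≤ ((p : ℝ)⁻¹) ^ (2 * m) * (1 * 1) := by
          gcongr
          exact PadicInt.norm_le_one r
      _ ≤ ((p : ℝ)⁻¹) ^ (m + 1) := by
          rw [mul_one, mul_one]; exact pow_le_pow_of_le_one hpi0 hpi1 (by omega)
  exact (IsUltrametricDist.norm_add_le_max _ _).trans (max_le hA hB)

/-- **THE EDGE READING `λ⁺ = p − 1`.** `p ≥ 3`, `f` a rational `a_p = 0` newform of level prime to `p`, `‖ϖ‖_p ≤ 1`, `L` any plus branch function,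
`m ≥ 1`. DISPLAYED (`θ = quadraticBranchMazurTateElement p f (2m)`, `c = coeff_{p−1}θ − (ω⁻_{2m})_{p−1}·coeff₀θ/p^m`; at `m = 1`: `c = b_{p−1} − b₀/p`):
`‖ϖ·coeff_jθ‖ ≤ p^{−(m+1)}` for `j < p − 1` and `‖ϖ·c‖ = p^{−m}`. CONCLUSION: `coeff_jL ∉ ℤ_pˣ` (`j < p − 1`), `coeff_{p−1}L ∈ ℤ_pˣ` — `μ(L) = 0`,
`λ(L) = p − 1`. [cite: Pollack2003, Prop. 6.18] [cite: Kobayashi2003, Thm. 3.2, (3.4), (3.6) (p. 7)] [cite: Washington1997, §7.1] -/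
theorem lambda_reading_plus_edge_of_padicNorm (hp3 : 3 ≤ p) (hf0 : IsNewform0 f) (hQ : coeffField f = ⊥)
    (hpN : ¬ p ∣ N) (hap : cuspCoeff f p = ((0 : ℤ) : ℂ)) {ϖ : ℚ} (hϖ : ‖(ϖ : ℚ_[p])‖ ≤ 1)
    {L : IwasawaAlgebra p} (hL : IsQuadraticBranchPlusLFunction f p ϖ L) (m : ℕ) (hm : 1 ≤ m)
    (hlow : ∀ j < p - 1,
      ‖(ϖ : ℚ_[p]) * (((quadraticBranchMazurTateElement p f (2 * m)).coeff j : ℚ) : ℚ_[p])‖ ≤ ((p : ℝ)⁻¹) ^ (m + 1))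
    (htop : ‖(ϖ : ℚ_[p]) * ((((quadraticBranchMazurTateElement p f (2 * m)).coeff (p - 1) : ℚ) : ℚ_[p]) -
      (((cyclotomicOmegaMinus p (2 * m)).coeff (p - 1) : ℤ) : ℚ_[p]) *
        (((quadraticBranchMazurTateElement p f (2 * m)).coeff 0 : ℚ) : ℚ_[p]) / (p : ℚ_[p]) ^ m)‖ = ((p : ℝ)⁻¹) ^ m) :
    (∀ j < p - 1, ¬ IsUnit (PowerSeries.coeff j L)) ∧ IsUnit (PowerSeries.coeff (p - 1) L) := by
  have hP : p.Prime := hp.out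
  have hp2 : p ≠ 2 := by omega
  have hp1 : (1 : ℝ) < p := by exact_mod_cast hP.one_lt
  have hp0 : (0 : ℝ) < p := by positivity
  obtain ⟨M, hM⟩ := exists_isCongrModOmega_quadraticBranch_even hp2 hf0 hQ hpN hap
  obtain ⟨v, hv⟩ := exists_units_forall_coeff_eq_plus hp2 hϖ hL hM
  have hsmall := forall_norm_le_of_forall_norm_theta_le_plus' hp2 hf0 hQ hpN hap m hm le_rfl (hM m) hϖ hlow
  have hnormL : ∀ j, ‖PowerSeries.coeff j L‖ = ‖(ϖ : ℚ_[p]) * ((PowerSeries.coeff j M : ℤ_[p]) : ℚ_[p])‖ := by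
    intro j
    rw [PadicInt.norm_def, hv j, norm_mul, PadicInt.padic_norm_e_of_padicInt, PadicInt.norm_units, one_mul]
  refine ⟨fun j hj hu ↦ ?_, ?_⟩
  · have h1 : ‖PowerSeries.coeff j L‖ = 1 := PadicInt.isUnit_iff.mp hu
    rw [hnormL] at h1
    have h2 := hsmall j hj
    rw [h1] at h2
    exact absurd h2 (not_le.mpr (inv_lt_one_of_one_lt₀ hp1))
  · obtain ⟨r, hr⟩ := exists_coeff_mazurTate_plus_eq_sum hp2 hf0 hQ hpN hap m (show p - 1 < p by omega) (hM m)
    have h0 := coeff_zero_mazurTate_plus_eq hp2 hf0 hQ hpN hap m (hM m)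
    have hstep := norm_corrected_sub_le_plus hp3 m hm hr h0 hϖ (fun t _ ht ↦ hsmall t ht)
    set a : ℚ_[p] := (ϖ : ℚ_[p]) * ((((quadraticBranchMazurTateElement p f (2 * m)).coeff (p - 1) : ℚ) : ℚ_[p]) -
      (((cyclotomicOmegaMinus p (2 * m)).coeff (p - 1) : ℤ) : ℚ_[p]) *
        (((quadraticBranchMazurTateElement p f (2 * m)).coeff 0 : ℚ) : ℚ_[p]) / (p : ℚ_[p]) ^ m) with ha
    set b : ℚ_[p] := (-1 : ℚ_[p]) ^ (m + 1) * (p : ℚ_[p]) ^ m *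
      ((ϖ : ℚ_[p]) * ((PowerSeries.coeff (p - 1) M : ℤ_[p]) : ℚ_[p])) with hb
    have hlt : ‖a - b‖ < ‖a‖ := by
      rw [htop]
      refine hstep.trans_lt ?_
      rw [pow_succ]
      exact mul_lt_of_lt_one_right (pow_pos (inv_pos.mpr hp0) m) (inv_lt_one_of_one_lt₀ hp1)
    have hnb : ‖b‖ = ‖a‖ := by
      have h := Padic.add_eq_max_of_ne (p := p) (q := a - b) (r := b) (by
        intro heq
        rw [heq] at hlt
        have := IsUltrametricDist.norm_add_le_max (a - b) b
        rw [sub_add_cancel, heq, max_self] at this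
        exact absurd (lt_of_le_of_lt this hlt) (lt_irrefl _))
      rw [sub_add_cancel] at h
      rcases le_total ‖a - b‖ ‖b‖ with hle | hle
      · rw [max_eq_right hle] at h; exact h.symm
      · rw [max_eq_left hle] at h; exact absurd h (ne_of_gt hlt)
    rw [htop, hb, norm_mul, norm_mul, norm_pow, norm_neg, norm_one, one_pow, one_mul, norm_pow, Padic.norm_p] at hnb
    have hone : ‖(ϖ : ℚ_[p]) * ((PowerSeries.coeff (p - 1) M : ℤ_[p]) : ℚ_[p])‖ = 1 := by
      have hpm : ((p : ℝ)⁻¹) ^ m ≠ 0 := pow_ne_zero _ (inv_ne_zero hp0.ne')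
      field_simp at hnb
      linarith [hnb]
    exact PadicInt.isUnit_iff.mpr (by rw [hnormL, hone])

/-- **The edge certificate in the tree's vocabulary**: same data ⟹ `HasUnitContent L`, `X1.MuLambda.mu L = 0`, `X1.MuLambda.lam L = p − 1`,
`normLam L = p − 1`. [cite: Pollack2003, Prop. 6.18] [cite: GreenbergVatsal2000, p. 2, (1)–(2)] [cite: Washington1997, §7.1] -/
theorem hasUnitContent_and_mu_lam_plus_edge_of_padicNorm (hp3 : 3 ≤ p) (hf0 : IsNewform0 f) (hQ : coeffField f = ⊥)
    (hpN : ¬ p ∣ N) (hap : cuspCoeff f p = ((0 : ℤ) : ℂ)) {ϖ : ℚ} (hϖ : ‖(ϖ : ℚ_[p])‖ ≤ 1)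
    {L : IwasawaAlgebra p} (hL : IsQuadraticBranchPlusLFunction f p ϖ L) (m : ℕ) (hm : 1 ≤ m)
    (hlow : ∀ j < p - 1,
      ‖(ϖ : ℚ_[p]) * (((quadraticBranchMazurTateElement p f (2 * m)).coeff j : ℚ) : ℚ_[p])‖ ≤ ((p : ℝ)⁻¹) ^ (m + 1))
    (htop : ‖(ϖ : ℚ_[p]) * ((((quadraticBranchMazurTateElement p f (2 * m)).coeff (p - 1) : ℚ) : ℚ_[p]) -
      (((cyclotomicOmegaMinus p (2 * m)).coeff (p - 1) : ℤ) : ℚ_[p]) *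
        (((quadraticBranchMazurTateElement p f (2 * m)).coeff 0 : ℚ) : ℚ_[p]) / (p : ℚ_[p]) ^ m)‖ = ((p : ℝ)⁻¹) ^ m) :
    HasUnitContent L ∧ X1.MuLambda.mu L = 0 ∧ X1.MuLambda.lam L = p - 1 ∧ normLam L = p - 1 :=
  hasUnitContent_and_mu_lam_of_firstUnitCoeff
    (lambda_reading_plus_edge_of_padicNorm hp3 hf0 hQ hpN hap hϖ hL m hm hlow htop)

/-- `ω⁻₂ = Φ_p(1+X)` is monic of degree `p − 1`: `(ω⁻₂)_{p−1} = 1` — so at level `2` the corrected top moment is `c = b_{p−1} − b₀/p`.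
[cite: Pollack2003, §6.5 (display before Prop. 6.18)] -/
theorem coeff_cyclotomicOmegaMinus_two_pred : (cyclotomicOmegaMinus p (2 * 1)).coeff (p - 1) = 1 := by
  have hP := hp.out
  rw [show 2 * 1 = 2 * 0 + 2 by rfl, ← cyclotomicOmegaMinus_two_mul_add_one, cyclotomicOmegaMinus_two_mul_add_one_eq_prod,
    Finset.prod_range_zero, mul_one]
  have hmonic : ((cyclotomic p ℤ).comp (X + 1)).Monic :=
    (cyclotomic.monic p ℤ).comp (monic_X_add_C 1)
      (by rw [show (X + 1 : ℤ[X]) = X + C 1 by rw [C_1], natDegree_X_add_C]; exact one_ne_zero)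
  have hdeg : ((cyclotomic p ℤ).comp (X + 1)).natDegree = p - 1 := by
    rw [natDegree_comp, natDegree_cyclotomic, Nat.totient_prime hP,
      show (X + 1 : ℤ[X]) = X + C 1 by rw [C_1], natDegree_X_add_C, mul_one]
  rw [← hdeg]
  exact hmonic.coeff_natDegree

end Summit.BirchSwinnertonDyer.BirchSwinnertonDyer.Theorems.EtaPlusCoeffCongruence

end
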